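import Summits.Ventures.QEC.CircuitDistance.PortK2DataBB144Z
import Summits.Ventures.QEC.CircuitDistance.K2Chunks
import HarnessLib

/-!
# K2(`[[144,12,12]]`) chunk module — COMPUTATIONAL (native_decide; `Lean.ofReduceBool`)

Cell `qec`, CDX, R146/R152 STEP 1 («computational» header; `ofReduceBool` confined to these chunk modules). Checker of record
`K2.K2Data` (qec-cdx-type-1, PortK2Check); data module of record `PortK2DataBB144X/Z` (p669158/9, crit-1 data audit PASS
2026-08-28T21:20Z); chunk glue `K2Chunks` (idea-1 g2). Cube 1, child 2: leaf group 3 of 4.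
Leaf theorems: the K2 DFS accepts below one descendant state of pivot cube 1 (sector Z); sizes are exact DFS visit counts
(eng-1 g2 `k2count.c`), capped so that the gate's native-axiom audit re-verifies every leaf in place. Assemblies re-derive the
child lists in the kernel (`decide`) and end in the literal cube fact `d144Z.cube (Ts144Z.getD 1 []) (72) (lives144Z.getD 1 0) = true`
(the `hcubes` hypothesis of `K2Inst.k2_complete`). Emitted by qec-cdx-eng-1 g2 (`gen2.py`, idea-1's `gen_k2chunks_from_lean.py` lineage).
-/

namespace Summit.Ventures.QEC.CircuitDistance.K2

set_option maxRecDepth 100000 in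
set_option maxHeartbeats 0 in
set_option exponentiation.threshold 1024 in
/-- K2(144) chunk fact `cube144Z1_ch2_10` (358170 DFS visits; see the module docstring). -/
theorem cube144Z1_ch2_10 : app5 (d144Z.dfs (Ts144Z.getD 1 []) 6) (577868402337513472, 2, 474284397516047136454946754595585670656196837984586242871765859553488494674313216, 3, 2348542582773833227889480596314589461502685719011213268033265189046963613869104739893010387728720052745142272) = true := by native_decide

set_option maxRecDepth 100000 in
set_option maxHeartbeats 0 in
set_option exponentiation.threshold 1024 in
/-- K2(144) chunk fact `cube144Z1_ch2_11` (457269 DFS visits; see the module docstring). -/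
theorem cube144Z1_ch2_11 : app5 (d144Z.dfs (Ts144Z.getD 1 []) 6) (594475168261210112, 2, 30354201441027016733116592294117482916376809840983802512125716497627455772000518144, 3, 2348542582773833227889480565960388020475668985894620973915782272759356753679424720333441485558340596413759488) = true := by native_decide

set_option maxRecDepth 100000 in
set_option maxHeartbeats 0 in
set_option exponentiation.threshold 1024 in
/-- K2(144) chunk fact `cube144Z1_ch2_12` (312414 DFS visits; see the module docstring). -/
theorem cube144Z1_ch2_12 : app5 (d144Z.dfs (Ts144Z.getD 1 []) 6) (1182340143547615805440, 0, 31082702275611665134711390509176302506278598627815026462521564703417925639599005106176, 3, 2348542582773833227889449483258112408810534274504111797613275994249931919447084691334885663089777313077788672) = true := by native_decide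

set_option maxRecDepth 100000 in
set_option maxHeartbeats 0 in
set_option exponentiation.threshold 1024 in
/-- K2(144) chunk fact `cube144Z1_ch2_13` (456522 DFS visits; see the module docstring). -/
theorem cube144Z1_ch2_13 : app5 (d144Z.dfs (Ts144Z.getD 1 []) 6) (149304460746493526032, 1860, 1989292945639146568621528992587283360401824692392371663884348473720233445126449171267584, 3, 2348542582773833227887460190312473262241912745511524514252874169646742528577322835427313025101727179575656448) = true := by native_decide

set_option maxRecDepth 100000 in
set_option maxHeartbeats 0 in
set_option exponentiation.threshold 1024 in
/-- K2(144) chunk fact `cube144Z1_ch2_14` (387159 DFS visits; see the module docstring). -/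
theorem cube144Z1_ch2_14 : app5 (d144Z.dfs (Ts144Z.getD 1 []) 6) (577588868413394944, 16, 2187250724783011924372502227117621365353169430893212436514973587204075491765523518680589492692189184, 3, 2348542580586582503104448265939971035124291380158355083359661733220971922167369836227937101878214002552602624) = true := by native_decide
end Summit.Ventures.QEC.CircuitDistance.K2
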